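import Literature.LinearAlgebra.RootSystem.AffineWeylGroupExtendedPoincareSeries
import Literature.LinearAlgebra.RootSystem.AffineWeylGroupOmegaCardinality
import HarnessLib

/-!
# Iwahori–Matsumoto's closed form for the Poincaré series of the affine Weyl groups (IM 1965 §1.10, Proposition 1.30)

N. Iwahori, H. Matsumoto, *On some Bruhat decomposition and the structure of the Hecke rings of p-adic Chevalley groups*, Publ. Math. IHÉS
25 (1965) 5–48 [IwahoriMatsumoto1965] (held `paper:doi-10-1007-bf02684396`, PDF pp. 20–22 = journal pp. 255–257), §1.10: «Now let `d ∈ P_r^⊥`,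
`w ∈ W`. We shall say that `d` is related to `w` if `Min λ(σ)` for `σ ∈ T(d)W` is attained by `T(d)w`. By Prop. 1.25, if `d` is related to `w`,
then … `λ(T(d)w) = Σ_{a>0,(a,d)≤0} |(a,d)| + Σ_{a>0,(a,d)>0} (|(a,d)| - 1) = Σ_{β∈Δ⁻} (d, wβ) - n(w)`. Let `Σ_{α∈Δ⁺} α = a_1α_1 + ⋯ + a_lα_l`
where `a_1, …, a_l` are positive integers. Then … `λ(T(d)w) = Σ_i a_i (d, -wε_i) - n(w)`. Now fix `w ∈ W`. Then `d` is related to `w` if and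
only if `(d, wβ) ≥ 0` for `β ∈ Δ⁻ ∩ w⁻¹Δ⁻` and `(d, wβ) > 0` for `β ∈ Δ⁻ ∩ w⁻¹Δ⁺`. These conditions are equivalent to [the same on] `α_i ∈ (-Π) ∩
w⁻¹Δ⁻` … and `α_i ∈ (-Π) ∩ w⁻¹Δ⁺`. In fact, let `-Π₁ = -Π ∩ w⁻¹Δ⁻`, `-Π₂ = -Π ∩ w⁻¹Δ⁺`. Then `Π₁, Π₂` form a partition of `Π` … Let `Θ(w)` be
the set of all `d ∈ P_r^⊥` which are related to `w ∈ W` … Then by what we have seen above, `d` is in `Θ(w)` if and only if `δ_1 ≥ 0, …, δ_r ≥ 0,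
δ_{r+1} > 0, …, δ_l > 0` where `δ_i(d) = …` Moreover if `d ∈ Θ(w)`, we have `λ(T(d)w) = Σ_i δ_i a_i - n(w)`. Thus we have obtained for a fixed
element `w ∈ W`: `Σ_{d∈Θ(w)} t^{λ(T(d)w)} = t^{-n(w)} Σ_{δ_1=0}^∞ ⋯ Σ_{δ_r=0}^∞ Σ_{δ_{r+1}=1}^∞ ⋯ Σ_{δ_l=1}^∞ t^{a_1δ_1+⋯+a_lδ_l} = t^{-n(w)} ·
1/(1-t^{a_1}) ⋯ 1/(1-t^{a_r}) · t^{a_{r+1}}/(1-t^{a_{r+1}}) ⋯ t^{a_l}/(1-t^{a_l})`. Let us denote by `a(w)` the integer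
`a(w) = Σ_{α_i ∈ Π ∩ w⁻¹Δ⁻} a_i`. Then we have `Σ_{d∈Θ(w)} t^{λ(T(d)w)} = t^{a(w)-n(w)} / Π_{i=1}^{l} (1 - t^{a_i})`. Since `DW` is a disjoint union
of the subsets `Θ'(w)W` … `P(DW, t) = P(W, t)/Π_{i=1}^{l}(1 - t^{a_i}) · Σ_{w∈W} t^{a(w)-n(w)}`. Thus we have proved **Proposition 1.30.**
`P(DW, t) = P(W, t) Σ_{w∈W} t^{a(w)-n(w)} / Π_{i=1}^{l} (1 - t^{a_i})`, `P(D'W, t) = P(W, t) Σ_{w∈W} t^{a(w)-n(w)} / (|Ω| Π_{i=1}^{l} (1 - t^{a_i}))`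
where `Σ_{α∈Δ⁺} α = Σ_i a_iα_i`, `a(w) = Σ_{α_i∈Π∩w⁻¹Δ⁻} a_i`.» (§1.10 opens with «cf. Bott [2, §§ 9, 15]» = [Bott1956].)
J. E. Humphreys, *Reflection Groups and Coxeter Groups* (1990) [Humphreys1990], §8.9 (pp. 179–180): Bott's formula for `W_a(t)`, obtained there
from the exponents; «The distinguished coset representatives `W^I` are then in bijection with the coroot lattice».

THIS FILE (lane `lit-hodgefound`, prover seat p40, generation 47, row g47-#9; THEOREMS ONLY — no definition, instance, notation or named fact; net
debt 0) proves Proposition 1.30 in the CONVENTIONS of the `AffineWeylGroup*` files (`Ŵ_a = DW` acts on `M` with translations `P(Φ)`, hyperplanes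
`⟨x, α^∨⟩ = k`; IM's `(α, d)` is `m_α = ⟨d, α^∨⟩`, so the dual-side data appear: `ϖ_j` the fundamental weights dual to the simple CO-roots,
`a_j := ⟨ϖ_j, Σ_{α≻0} α^∨⟩` the coefficients of `Σ_{α≻0} α^∨`, supplied as `a : Δ → ℕ` with `ha : (a_j : K) = Σ_{α≻0} ⟨ϖ_j, α^∨⟩` — such `a`
exists and `a_j ≥ 1`, §2). For `g ∈ Aut P`: `n(g) := Card {α ≻ 0 | gα ≺ 0}`, `a(g) := Σ_{j : gα_j ≺ 0} a_j`, «related» := the minimiser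
condition `∀ α ≻ 0, (g⁻¹α ≻ 0 ↔ m_α ≤ 0)` of Proposition 1.25 (row g45-#14), `μ(m) := Σ_{α≻0} (if m_α ≤ 0 then |m_α| else |m_α| - 1)` its
minimum value; the Weyl group enters the closed forms through any finite set `W` enumerating it (it is finite; §7). All identities are stated
MULTIPLIED OUT in `ℤ⟦t⟧` (no division of power series).

* §1 (generic combinatorics) ★★ `prod_one_sub_X_pow_mul_mk_ncard_cone` («`Σ_{δ_1=0}^∞ ⋯ Σ_{δ_l=1}^∞ t^{a_1δ_1+⋯+a_lδ_l} = Π …`», multiplied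
  out: `(Π_j (1 - t^{a_j})) · Σ_k Card {δ ≥ e | Σ a_jδ_j = k} t^k = t^{Σ a_j e_j}` for `a_j ≥ 1`, by freezing one coordinate at a time).
* §2 ★ `exists_nat_cast_eq_sum_coroot'_fundamental` (the `a_j` are positive integers).
* §3 ★★ `forall_isPos_inv_smul_iff_le_iff` («these conditions are equivalent to» the ones at the simple roots: `d` is related to `g` iff
  `m_{gα_j} ≤ 0` for `gα_j ≻ 0` and `m_{gα_j} ≤ -1` for `gα_j ≺ 0` — via the regular dominant point `g⁻¹(x₀ - d)`).
* §4 ★★ `sum_min_add_card_eq_neg_sum` («`λ(T(d)w) = Σ_{β∈Δ⁻}(d, wβ) - n(w)`»: `μ(m) + n(g) = -Σ_{γ≻0} m_{gγ}` for `d` related to `g`).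
* §5 ★★ `forall_iff_and_sum_min_add_card_eq` («if `d ∈ Θ(w)`, `λ(T(d)w) = Σ_i δ_i a_i - n(w)`» for `d = g·(-Σ_j δ_j ϖ_j)`), ★★★
  `ncard_related_eq_ncard_cone` (`Θ(g) ↔ {δ ∈ ℕ^Δ | δ_j ≥ [gα_j ≺ 0]}`, weight-preservingly: `Card {d ∈ Θ(g) | μ(d) = k} = Card {δ | Σ a_jδ_j =
  k + n(g)}`), ★★ `ncard_weightLattice_sum_min_eq_sum_ncard_related` (`P(Φ) = ⊔_{w∈W} Θ(w)`, counted).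
* §6 ★ `card_filter_le_sum_mul_ite` (`n(g) ≤ a(g)`), ★★★ `prod_one_sub_X_pow_mul_mk_ncard_related` («`Σ_{d∈Θ(w)} t^{λ(T(d)w)} = t^{a(w)-n(w)} /
  Π(1 - t^{a_i})`»), ★★★ `prod_one_sub_X_pow_mul_mk_ncard_weightLattice` (`(Π_j(1 - t^{a_j})) · Σ_{d∈P(Φ)} t^{μ(d)} = Σ_{w∈W} t^{a(w)-n(w)}`).
* §7 ★★★ `prod_one_sub_X_pow_mul_mk_ncard_extendedAffineWeylGroup` (PROPOSITION 1.30 FOR `DW = Ŵ_a`: `(Π_j(1 - t^{a_j})) · Ŵ_a(t) = (Σ_{w∈W}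
  t^{n(w)}) · Σ_{w∈W} t^{a(w)-n(w)}`, with row g47-#8), ★★★ `natAbs_det_smul_prod_one_sub_X_pow_mul_poincareSeries_affineWeylGroup` (PROPOSITION
  1.30 FOR `D'W = W_a`: `|det C| · (Π_j(1 - t^{a_j})) · W_a(t) = (Σ_{w∈W} t^{n(w)}) · Σ_{w∈W} t^{a(w)-n(w)}`, `W_a(t)` the Poincaré series of the
  Coxeter group `W_a`, `|Ω| = |det C|` rows g47-#3, g47-#6), ★★ `mk_ncard_length_weylGroup_eq_sum` («`P(W, t) = Σ_{w′∈W} t^{n(w′)}`»), ★★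
  `card_filter_sum_mul_ite_eq_card_eq_natAbs_det` (constant terms: `Card {w ∈ W | a(w) = n(w)} = |det C| = |Ω|`), ★★
  `natAbs_det_smul_prod_one_sub_X_pow_mul_mk_ncard_rootSpan` (`|det C|·(Π_j(1 - t^{a_j}))·Σ_{d∈Q} t^{μ(d)} = Σ_{w∈W} t^{a(w)-n(w)}`: the series of
  `W^I ↔ Q` of row g47-#3 in closed form).

BY NAME, nothing restated: rows g47-#8 (`mk_ncard_extendedAffineWeylGroup_eq_mul`, `finite_weightLattice_sum_min_eq`), g47-#3
(`mk_ncard_extendedAffineWeylGroup_eq_smul`), g47-#6 (`natCard_stabilizer_eq_natAbs_det`), g45-#14 (`exists_weylGroup_forall_isPos_inv_smul_iff_le`,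
`weylGroup_unique_of_forall_isPos_inv_smul_iff`), g45-#4 (`sum_eq_two_mul_sum_filter_isPos`, `exists_coroot'_eq_intCast_of_mem_weightLattice`), g44
(`smul_sum_filter_isPos_mem_fundamentalAlcove`, `smul_mem_weightLattice`), g36-#5 (`length_weylGroup_eq_card_filter`), `FundamentalWeights`
(`eq_sum_coroot'_smul`, `exists_int_coroot'_fundamental`), `WeylVector` (`coroot'_pos_of_isPos_of_forall_mem_support`,
`coroot'_nonneg_of_isPos_of_forall_mem_support`), `WeylGroupSimpleReflections` (`coroot'_smul_smul`), `WeylGroupFundamentalDomain` (`finite_weylGroup`).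

## Scope caveats

IM's second displayed form of `P(DW, t)` through `Max λ(T(d)w)` and `b(w)` (p. 257, «similarly») and Bott's form through the exponents
(`Π_i 1/(1 - t^{m_i})`, [Humphreys1990] §8.9) are NOT derived. The identities are stated multiplied out in `ℤ⟦t⟧`; `n(g) ≤ a(g)` (§6) makes the
exponent `a(g) - n(g)` an honest natural number. Finite reduced crystallographic root SYSTEMS (`[P.IsRootSystem]`, for the fundamental weights)
over an ordered field of characteristic zero; `η`, `hη` (highest co-root, so that `A∘` is an alcove); §7's second formula for a Coxeter system
`cs` on `W_a` whose simple reflections are the walls of `A∘` (row g45-#1; it exists, `exists_coxeterSystem_affineWeylGroup`).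

## References

* [IwahoriMatsumoto1965] N. Iwahori, H. Matsumoto, Publ. Math. IHÉS 25 (1965) 5–48, §1.10, Proposition 1.30 (pp. 255–257).
* [Humphreys1990] J. E. Humphreys, *Reflection Groups and Coxeter Groups*, CUP (1990), §4.5, §8.9 (pp. 179–180).
* [Bott1956] R. Bott, Bull. Soc. Math. France 84 (1956) 251–281 (cite-only, via [IwahoriMatsumoto1965] §1.10 and [Humphreys1990] §8.9).
-/

noncomputable section

open Module Set Function PowerSeries
open Literature.GroupTheory.Coxeter Literature.GroupTheory.Coxeter.PreCoxeterSystem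

namespace Literature.LinearAlgebra.RootSystem

/-! ## §1 The generating function of a shifted cone: `Π_j (1 - t^{a_j}) · Σ_{δ ≥ e} t^{Σ_j a_j δ_j} = t^{Σ_j a_j e_j}` -/

section Cone

variable {σ : Type*} [Fintype σ] [DecidableEq σ]

/-- The weight `Σ_i a_i δ_i` after changing one coordinate. [cite: IwahoriMatsumoto1965, §1.10 (p. 256)] -/
private theorem sum_mul_update_add (a δ : σ → ℕ) (j : σ) (v : ℕ) :
    ∑ i, a i * Function.update δ j v i + a j * δ j = ∑ i, a i * δ i + a j * v := by
  rw [← Finset.add_sum_erase Finset.univ (fun i ↦ a i * Function.update δ j v i) (Finset.mem_univ j),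
    ← Finset.add_sum_erase Finset.univ (fun i ↦ a i * δ i) (Finset.mem_univ j), Function.update_self]
  have h : ∑ i ∈ Finset.univ.erase j, a i * Function.update δ j v i = ∑ i ∈ Finset.univ.erase j, a i * δ i :=
    Finset.sum_congr rfl fun i hi ↦ by rw [Function.update_of_ne (Finset.ne_of_mem_erase hi)]
  rw [h]
  ring

omit [DecidableEq σ] in
/-- The slices `{δ ≥ e, δ frozen on S, Σ a_i δ_i = k}` are finite when all `a_i ≥ 1` (`δ_i ≤ k`). [cite: IwahoriMatsumoto1965, §1.10 (p. 256)] -/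
private theorem finite_cone_slice (a e : σ → ℕ) (ha : ∀ j, 1 ≤ a j) (S : Finset σ) (k : ℕ) :
    {δ : σ → ℕ | (∀ i, e i ≤ δ i) ∧ (∀ i ∈ S, δ i = e i) ∧ ∑ i, a i * δ i = k}.Finite := by
  refine (Set.Finite.pi' (fun _ : σ ↦ Set.finite_Iic k)).subset ?_
  rintro δ ⟨-, -, hk⟩ j
  rw [Set.mem_Iic, ← hk]
  calc δ j ≤ a j * δ j := Nat.le_mul_of_pos_left _ (ha j)
    _ ≤ ∑ i, a i * δ i := Finset.single_le_sum (fun i _ ↦ Nat.zero_le (a i * δ i)) (Finset.mem_univ j)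

/-- Freezing one more coordinate: `(1 - t^{a_j}) · T_S(t) = T_{S ∪ {j}}(t)` for `j ∉ S`, where `T_S(t)` counts the `δ ≥ e` frozen on `S` by
weight — the `δ` with `δ_j ≥ e_j + 1` are `δ' + 1_j` for the `δ' ≥ e` of weight `k - a_j`. [cite: IwahoriMatsumoto1965, §1.10 (p. 256, "Σ_{δ_i = 1}^∞ … = t^{a_i}/(1 - t^{a_i})")] -/
private theorem one_sub_X_pow_mul_cone (a e : σ → ℕ) (ha : ∀ j, 1 ≤ a j) (S : Finset σ) {j : σ} (hj : j ∉ S) :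
    (1 - (X : PowerSeries ℤ) ^ a j) *
        PowerSeries.mk (fun k ↦ ({δ : σ → ℕ | (∀ i, e i ≤ δ i) ∧ (∀ i ∈ S, δ i = e i) ∧ ∑ i, a i * δ i = k}.ncard : ℤ)) =
      PowerSeries.mk (fun k ↦ ({δ : σ → ℕ | (∀ i, e i ≤ δ i) ∧ (∀ i ∈ insert j S, δ i = e i) ∧ ∑ i, a i * δ i = k}.ncard : ℤ)) := by
  ext k
  rw [sub_mul, one_mul, map_sub, coeff_mk, coeff_X_pow_mul', coeff_mk]
  -- `T_{S,k} = T_{S∪j,k} ⊔ U_k`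
  have hsplit : {δ : σ → ℕ | (∀ i, e i ≤ δ i) ∧ (∀ i ∈ S, δ i = e i) ∧ ∑ i, a i * δ i = k} =
      {δ : σ → ℕ | (∀ i, e i ≤ δ i) ∧ (∀ i ∈ insert j S, δ i = e i) ∧ ∑ i, a i * δ i = k} ∪
        {δ : σ → ℕ | ((∀ i, e i ≤ δ i) ∧ (∀ i ∈ S, δ i = e i) ∧ ∑ i, a i * δ i = k) ∧ e j + 1 ≤ δ j} := by
    ext δ
    simp only [Set.mem_setOf_eq, Set.mem_union, Finset.forall_mem_insert]
    constructor
    · rintro ⟨he, hS, hk⟩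
      by_cases h : δ j = e j
      · exact Or.inl ⟨he, ⟨h, hS⟩, hk⟩
      · exact Or.inr ⟨⟨he, hS, hk⟩, by have := he j; omega⟩
    · rintro (⟨he, ⟨-, hS⟩, hk⟩ | ⟨h, -⟩)
      · exact ⟨he, hS, hk⟩
      · exact h
  have hdisj : Disjoint {δ : σ → ℕ | (∀ i, e i ≤ δ i) ∧ (∀ i ∈ insert j S, δ i = e i) ∧ ∑ i, a i * δ i = k}
      {δ : σ → ℕ | ((∀ i, e i ≤ δ i) ∧ (∀ i ∈ S, δ i = e i) ∧ ∑ i, a i * δ i = k) ∧ e j + 1 ≤ δ j} := by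
    rw [Set.disjoint_left]
    rintro δ ⟨-, hS, -⟩ ⟨-, hj'⟩
    have := hS j (Finset.mem_insert_self j S)
    omega
  -- `U_k = (· + 1_j) '' T_{S, k - a_j}` for `a_j ≤ k`, and `U_k = ∅` otherwise
  have hU : {δ : σ → ℕ | ((∀ i, e i ≤ δ i) ∧ (∀ i ∈ S, δ i = e i) ∧ ∑ i, a i * δ i = k) ∧ e j + 1 ≤ δ j}.ncard =
      if a j ≤ k then {δ : σ → ℕ | (∀ i, e i ≤ δ i) ∧ (∀ i ∈ S, δ i = e i) ∧ ∑ i, a i * δ i = k - a j}.ncard else 0 := by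
    split_ifs with hle
    · have himg : {δ : σ → ℕ | ((∀ i, e i ≤ δ i) ∧ (∀ i ∈ S, δ i = e i) ∧ ∑ i, a i * δ i = k) ∧ e j + 1 ≤ δ j} =
          (fun δ : σ → ℕ ↦ Function.update δ j (δ j + 1)) ''
            {δ : σ → ℕ | (∀ i, e i ≤ δ i) ∧ (∀ i ∈ S, δ i = e i) ∧ ∑ i, a i * δ i = k - a j} := by
        ext δ
        simp only [Set.mem_setOf_eq, Set.mem_image]
        constructor
        · rintro ⟨⟨he, hS, hk⟩, hj'⟩
          refine ⟨Function.update δ j (δ j - 1), ⟨fun i ↦ ?_, fun i hi ↦ ?_, ?_⟩, ?_⟩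
          · by_cases hij : i = j
            · subst hij; rw [Function.update_self]; omega
            · rw [Function.update_of_ne hij]; exact he i
          · rw [Function.update_of_ne (ne_of_mem_of_not_mem hi hj)]; exact hS i hi
          · have h1 := sum_mul_update_add a δ j (δ j - 1)
            have hδ : 1 ≤ δ j := by have := he j; omega
            have h2 : a j * (δ j - 1) + a j = a j * δ j := by
              rw [← Nat.mul_succ, Nat.succ_eq_add_one, Nat.sub_add_cancel hδ]
            omega
          · ext i
            by_cases hij : i = j
            · subst hij; rw [Function.update_self, Function.update_self]; omega
            · rw [Function.update_of_ne hij, Function.update_of_ne hij]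
        · rintro ⟨δ', ⟨he, hS, hk⟩, rfl⟩
          refine ⟨⟨fun i ↦ ?_, fun i hi ↦ ?_, ?_⟩, ?_⟩
          · by_cases hij : i = j
            · subst hij; rw [Function.update_self]; exact (he i).trans (Nat.le_succ _)
            · rw [Function.update_of_ne hij]; exact he i
          · rw [Function.update_of_ne (ne_of_mem_of_not_mem hi hj)]; exact hS i hi
          · have h1 := sum_mul_update_add a δ' j (δ' j + 1)
            rw [Nat.mul_add, mul_one] at h1
            omega
          · rw [Function.update_self]; exact Nat.succ_le_succ (he j)
      rw [himg, Set.ncard_image_of_injective]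
      intro δ δ' h
      have h' : Function.update δ j (δ j + 1) = Function.update δ' j (δ' j + 1) := h
      ext i
      by_cases hij : i = j
      · subst hij
        have h1 := congr_fun h' i
        rw [Function.update_self, Function.update_self] at h1
        omega
      · have h1 := congr_fun h' i
        rwa [Function.update_of_ne hij, Function.update_of_ne hij] at h1
    · rw [Set.ncard_eq_zero ((finite_cone_slice a e ha S k).subset fun δ hδ ↦ hδ.1)]
      · ext δ
        simp only [Set.mem_setOf_eq, Set.mem_empty_iff_false, iff_false, not_and, not_le]
        rintro ⟨-, -, hk⟩
        have h1 : a j * δ j ≤ ∑ i, a i * δ i := Finset.single_le_sum (fun i _ ↦ Nat.zero_le (a i * δ i)) (Finset.mem_univ j)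
        rw [hk] at h1
        by_contra h2
        push Not at h2
        have h3 : a j * 1 ≤ a j * δ j := Nat.mul_le_mul_left _ (by omega)
        omega
  rw [hsplit, Set.ncard_union_eq hdisj ((finite_cone_slice a e ha _ k).subset fun δ hδ ↦ ⟨hδ.1, fun i hi ↦ hδ.2.1 i
      (Finset.mem_insert_of_mem hi), hδ.2.2⟩) ((finite_cone_slice a e ha S k).subset fun δ hδ ↦ hδ.1), Nat.cast_add, hU]
  split_ifs with hle
  · rw [coeff_mk]; ring
  · rw [Nat.cast_zero, coeff_mk]; ring

/-- Freezing the coordinates in `S`: `(Π_{j∈S} (1 - t^{a_j})) · Σ_{δ ≥ e} t^{wt δ} = T_S(t)`. [cite: IwahoriMatsumoto1965, §1.10 (p. 256)] -/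
private theorem prod_one_sub_X_pow_mul_cone (a e : σ → ℕ) (ha : ∀ j, 1 ≤ a j) (S : Finset σ) :
    (∏ j ∈ S, (1 - (X : PowerSeries ℤ) ^ a j)) *
        PowerSeries.mk (fun k ↦ ({δ : σ → ℕ | (∀ i, e i ≤ δ i) ∧ ∑ i, a i * δ i = k}.ncard : ℤ)) =
      PowerSeries.mk (fun k ↦ ({δ : σ → ℕ | (∀ i, e i ≤ δ i) ∧ (∀ i ∈ S, δ i = e i) ∧ ∑ i, a i * δ i = k}.ncard : ℤ)) := by
  induction S using Finset.induction_on with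
  | empty =>
    rw [Finset.prod_empty, one_mul]
    simp only [Finset.notMem_empty, false_implies, implies_true, true_and]
  | insert j S hj ih =>
    rw [Finset.prod_insert hj, mul_assoc, ih, one_sub_X_pow_mul_cone a e ha S hj]

/-- ★★ **THE GENERATING FUNCTION OF A SHIFTED CONE** (IM p. 256: «`Σ_{d∈Θ(w)} t^{λ(T(d)w)} = t^{-n(w)} Σ_{δ_1=0}^∞ ⋯ Σ_{δ_r=0}^∞ Σ_{δ_{r+1}=1}^∞ ⋯
Σ_{δ_l=1}^∞ t^{a_1δ_1+⋯+a_lδ_l} = t^{-n(w)} · 1/(1-t^{a_1}) ⋯ 1/(1-t^{a_r}) · t^{a_{r+1}}/(1-t^{a_{r+1}}) ⋯ t^{a_l}/(1-t^{a_l})`»), multiplied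
out in `ℤ⟦t⟧`: for positive integers `a_j` and a corner `e ∈ ℕ^σ`,
`(Π_j (1 - t^{a_j})) · Σ_k Card {δ ∈ ℕ^σ | δ ≥ e, Σ_j a_j δ_j = k} t^k = t^{Σ_j a_j e_j}`. [cite: IwahoriMatsumoto1965, §1.10 (p. 256)] -/
theorem prod_one_sub_X_pow_mul_mk_ncard_cone (a e : σ → ℕ) (ha : ∀ j, 1 ≤ a j) :
    (∏ j, (1 - (X : PowerSeries ℤ) ^ a j)) *
        PowerSeries.mk (fun k ↦ ({δ : σ → ℕ | (∀ i, e i ≤ δ i) ∧ ∑ i, a i * δ i = k}.ncard : ℤ)) =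
      X ^ (∑ j, a j * e j) := by
  rw [prod_one_sub_X_pow_mul_cone a e ha Finset.univ]
  ext k
  rw [coeff_mk, coeff_X_pow]
  have h1 : {δ : σ → ℕ | (∀ i, e i ≤ δ i) ∧ (∀ i ∈ (Finset.univ : Finset σ), δ i = e i) ∧ ∑ i, a i * δ i = k} =
      if k = ∑ j, a j * e j then {e} else ∅ := by
    ext δ
    simp only [Set.mem_setOf_eq, Finset.mem_univ, forall_const]
    constructor
    · rintro ⟨-, hS, hk⟩
      have hδ : δ = e := funext hS
      subst hδ
      rw [if_pos hk.symm]
      exact Set.mem_singleton _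
    · intro h
      split_ifs at h with hk
      · rw [Set.mem_singleton_iff] at h
        subst h
        exact ⟨fun _ ↦ le_rfl, fun _ ↦ rfl, hk.symm⟩
      · exact absurd h (Set.notMem_empty _)
  rw [h1]
  split_ifs with hk
  · rw [Set.ncard_singleton, Nat.cast_one]
  · rw [Set.ncard_empty, Nat.cast_zero]

/-- Cancelling a power of `t`. [cite: IwahoriMatsumoto1965, §1.10] -/
private theorem eq_of_X_pow_mul_eq {R : Type*} [CommSemiring R] (n : ℕ) {F G : PowerSeries R} (h : X ^ n * F = X ^ n * G) : F = G := by
  ext k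
  have h1 := congrArg (coeff (k + n)) h
  rwa [coeff_X_pow_mul, coeff_X_pow_mul] at h1

end Cone

namespace Base

variable {ι K M N : Type*} [Field K] [LinearOrder K] [IsStrictOrderedRing K] [AddCommGroup M] [Module K M]
  [AddCommGroup N] [Module K N] [Fintype ι] [DecidableEq ι]
  {P : RootPairing ι K M N} [CharZero K] [P.IsCrystallographic] [P.IsReduced] (b : P.Base)

/-! ## §0 Bookkeeping -/

section Aux

omit [LinearOrder K] [IsStrictOrderedRing K] [Fintype ι] [DecidableEq ι] [CharZero K] [P.IsCrystallographic] [P.IsReduced] in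
/-- An automorphism of `P` commutes with `α ↦ -α` on indices: `g(-α_i) = -(gα_i)`. [cite: IwahoriMatsumoto1965, §1.1 ("P, P_r are stable under W")] -/
private theorem smul_reflectionPerm_self (g : P.Aut) (i : ι) :
    g • P.reflectionPerm i i = P.reflectionPerm (g • i) (g • i) := by
  apply P.root.injective
  rw [smul_index_eq, smul_index_eq, RootPairing.Equiv.root_indexEquiv_eq_smul, RootPairing.root_reflectionPerm,
    RootPairing.root_reflectionPerm, RootPairing.reflection_apply_self, RootPairing.reflection_apply_self, smul_neg,
    RootPairing.Equiv.root_indexEquiv_eq_smul]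

omit [LinearOrder K] [IsStrictOrderedRing K] [Fintype ι] [DecidableEq ι] [CharZero K] [P.IsCrystallographic] [P.IsReduced] in
/-- `⟨x, (-α_i)^∨⟩ = -⟨x, α_i^∨⟩`. [cite: IwahoriMatsumoto1965, §1.9 ("(-α, d) = -(α, d)")] -/
private theorem coroot'_reflectionPerm_self_self_apply (i : ι) (x : M) : P.coroot' (P.reflectionPerm i i) x = -P.coroot' i x := by
  rw [RootPairing.coroot'_reflectionPerm, LinearMap.coe_comp, comp_apply, LinearEquiv.coe_coe, RootPairing.reflection_apply,
    map_sub, map_smul, RootPairing.root_coroot'_eq_pairing, RootPairing.pairing_same, smul_eq_mul]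
  ring

omit [LinearOrder K] [IsStrictOrderedRing K] [Fintype ι] [DecidableEq ι] [P.IsCrystallographic] [P.IsReduced] in
/-- Integer levels are odd: `m_{-α} = -m_α`. [cite: IwahoriMatsumoto1965, §1.9] -/
private theorem levels_neg {d : M} {m : ι → ℤ} (hm : ∀ i, P.coroot' i d = m i) (i : ι) : m (P.reflectionPerm i i) = -m i := by
  have h1 := hm (P.reflectionPerm i i)
  rw [coroot'_reflectionPerm_self_self_apply, hm i] at h1
  exact_mod_cast h1.symm

omit [LinearOrder K] [IsStrictOrderedRing K] [Fintype ι] [DecidableEq ι] [CharZero K] [P.IsCrystallographic] [P.IsReduced] in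
/-- `-(-α) = α` on indices. [cite: IwahoriMatsumoto1965, §1.1] -/
private theorem reflectionPerm_self_self_self (i : ι) : P.reflectionPerm (P.reflectionPerm i i) (P.reflectionPerm i i) = i := by
  letI := P.indexNeg
  exact neg_neg i

/-- Each summand of `μ(m)` is nonnegative. [cite: IwahoriMatsumoto1965, §1.9 Proposition 1.25] -/
private theorem summand_min_nonneg (m : ℤ) : (0 : ℤ) ≤ (if m ≤ 0 then |m| else |m| - 1) := by
  by_cases h : m ≤ 0
  · rw [if_pos h]; exact abs_nonneg _
  · rw [if_neg h, abs_of_nonneg (show (0 : ℤ) ≤ m by omega)]; omega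

end Aux

/-! ## §2 The positive integers `a_j` («`Σ_{α∈Δ⁺} α = a_1α_1 + ⋯ + a_lα_l` where `a_1, …, a_l` are positive integers», dual side) -/

section Coefficients

variable [DecidablePred b.IsPos] {ϖ : b.support → M} (hϖ : ∀ i j : b.support, P.coroot' j (ϖ i) = if i = j then 1 else 0)

include hϖ

/-- ★ **THE POSITIVE INTEGERS `a_j := ⟨ϖ_j, Σ_{α≻0} α^∨⟩`** (the coefficients of `Σ_{α≻0} α^∨` on the simple co-roots; IM's «`Σ_{α∈Δ⁺} α = a_1α_1 +
⋯ + a_lα_l` where `a_1, …, a_l` are positive integers», on the dual side of the CONVENTION): each `⟨ϖ_j, α^∨⟩` (`α ≻ 0`) is a nonnegative integer and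
`⟨ϖ_j, α_j^∨⟩ = 1`, so `a_j ∈ ℕ`, `a_j ≥ 1`. [cite: IwahoriMatsumoto1965, §1.10 (p. 256, "where a_1, …, a_l are positive integers")] -/
theorem exists_nat_cast_eq_sum_coroot'_fundamental :
    ∃ a : b.support → ℕ, ∀ j, (a j : K) = ∑ i ∈ Finset.univ.filter b.IsPos, P.coroot' i (ϖ j) ∧ 1 ≤ a j := by
  have hint : ∀ (j : b.support) (i : ι), b.IsPos i → ∃ n : ℕ, P.coroot' i (ϖ j) = n := by
    intro j i hi
    obtain ⟨z, hz⟩ := exists_int_coroot'_fundamental hϖ j i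
    have h0 : (0 : K) ≤ P.coroot' i (ϖ j) :=
      coroot'_nonneg_of_isPos_of_forall_mem_support b (fun k hk ↦ by rw [hϖ j ⟨k, hk⟩]; split_ifs <;> norm_num) hi
    rw [hz] at h0
    have h0' : (0 : ℤ) ≤ z := by exact_mod_cast h0
    refine ⟨z.toNat, ?_⟩
    rw [hz, show ((z.toNat : ℕ) : K) = ((z.toNat : ℤ) : K) from by norm_cast, Int.toNat_of_nonneg h0']
  choose! c hc using hint
  refine ⟨fun j ↦ ∑ i ∈ Finset.univ.filter b.IsPos, c j i, fun j ↦ ⟨?_, ?_⟩⟩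
  · rw [Nat.cast_sum]
    exact Finset.sum_congr rfl fun i hi ↦ (hc j i (Finset.mem_filter.mp hi).2).symm
  · have hj : (j : ι) ∈ Finset.univ.filter b.IsPos := Finset.mem_filter.mpr ⟨Finset.mem_univ _, b.isPos_of_mem_support j.2⟩
    have h1 : c j j = 1 := by
      have h2 := hc j j (b.isPos_of_mem_support j.2)
      rw [hϖ j j, if_pos rfl] at h2
      exact_mod_cast h2.symm
    calc 1 = c j j := h1.symm
      _ ≤ ∑ i ∈ Finset.univ.filter b.IsPos, c j i := Finset.single_le_sum (fun i _ ↦ Nat.zero_le (c j i)) hj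

end Coefficients

/-! ## §3 «`d` is related to `w`» through the simple roots only -/

section Related

variable [Nonempty ι] {η : ι} (hη : ∀ k, P.coroot η - P.coroot k ∈ AddSubmonoid.closure (P.coroot '' (b.support : Set ι)))

include hη

omit [DecidableEq ι] in
/-- ★★ **«THESE CONDITIONS ARE EQUIVALENT TO `(d, wα_i) ≤ 0` FOR `α_i ∈ (-Π) ∩ w⁻¹Δ⁻`… AND … FOR `α_i ∈ (-Π) ∩ w⁻¹Δ⁺`» — THE RELATION «`d` IS RELATED
TO `w`» IS DECIDED ON THE SIMPLE ROOTS**: for `d` with integer levels `m_α = ⟨d, α^∨⟩` and `g ∈ Aut P`, the minimiser condition of Proposition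
1.25, `∀ α ≻ 0, (g⁻¹α ≻ 0 ↔ m_α ≤ 0)` («`wΔ⁺ = {α∈Δ⁺; (α,d) ≤ 0} ∪ {α∈Δ⁻; (α,d) < 0}`»), holds iff for every SIMPLE root `α_j`:
`m_{gα_j} ≤ 0` if `gα_j ≻ 0` and `m_{gα_j} ≤ -1` if `gα_j ≺ 0`. (IM prove it by decomposing a root on `Π₁ ∪ Π₂`; here: the conditions say that
`g⁻¹(x₀ - d)`, `x₀ ∈ A∘`, lies in the open dominant chamber, which is cut out by the simple co-roots, tree `coroot'_pos_of_isPos_of_forall_mem_support`.)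
[cite: IwahoriMatsumoto1965, §1.10 (p. 256, "These conditions are equivalent to … In fact, let -Π₁ = -Π ∩ w⁻¹Δ⁻, -Π₂ = -Π ∩ w⁻¹Δ⁺. Then Π₁, Π₂ form a partition of Π")] -/
theorem forall_isPos_inv_smul_iff_le_iff {d : M} {m : ι → ℤ} (hm : ∀ i, P.coroot' i d = m i) (g : P.Aut) :
    (∀ i, b.IsPos i → (b.IsPos (g⁻¹ • i) ↔ m i ≤ 0)) ↔
      ∀ j ∈ b.support, (b.IsPos (g • j) → m (g • j) ≤ 0) ∧ (¬ b.IsPos (g • j) → m (g • j) ≤ -1) := by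
  classical
  have hneg := levels_neg hm
  constructor
  · intro h j hj
    refine ⟨fun hpos ↦ (h (g • j) hpos).mp (by rw [inv_smul_smul]; exact b.isPos_of_mem_support hj), fun hnpos ↦ ?_⟩
    have hpos' : b.IsPos (g • P.reflectionPerm j j) := by
      rw [smul_reflectionPerm_self]
      exact (RootPairing.Base.IsPos.neg_iff_not b _).mpr hnpos
    have h1 := h _ hpos'
    rw [inv_smul_smul] at h1
    have h2 : ¬ b.IsPos (P.reflectionPerm j j) := (RootPairing.Base.IsPos.neg_iff_not b j).not.mpr (not_not.mpr (b.isPos_of_mem_support hj))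
    have h3 : ¬ m (g • P.reflectionPerm j j) ≤ 0 := fun h4 ↦ h2 (h1.mpr h4)
    rw [smul_reflectionPerm_self, hneg] at h3
    omega
  · intro h i hi
    -- the point `y = g⁻¹(x₀ - d)` is regular dominant
    have hx₀ := smul_sum_filter_isPos_mem_fundamentalAlcove b hη
    set x₀ : M := (P.coroot' η (∑ k ∈ Finset.univ.filter b.IsPos, P.root k) + 1)⁻¹ • (∑ k ∈ Finset.univ.filter b.IsPos, P.root k) with hx₀def
    set y : M := g⁻¹ • (x₀ - d) with hy
    have hlev : ∀ β, P.coroot' β y = P.coroot' (g • β) x₀ - m (g • β) := by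
      intro β
      rw [← coroot'_smul_smul g β y, hy, smul_inv_smul, map_sub, hm]
    have hydom : ∀ j ∈ b.support, 0 < P.coroot' j y := by
      intro j hj
      rw [hlev]
      by_cases hpos : b.IsPos (g • j)
      · have h1 := (hx₀ (g • j) hpos).1
        have h2 : ((m (g • j) : ℤ) : K) ≤ 0 := by exact_mod_cast (h j hj).1 hpos
        linarith
      · have hpos' : b.IsPos (P.reflectionPerm (g • j) (g • j)) := (RootPairing.Base.IsPos.neg_iff_not b _).mpr hpos
        have h1 := (hx₀ _ hpos').2
        rw [coroot'_reflectionPerm_self_self_apply] at h1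
        have h2 : ((m (g • j) : ℤ) : K) ≤ -1 := by exact_mod_cast (h j hj).2 hpos
        linarith
    have hypos : ∀ γ, b.IsPos γ → 0 < P.coroot' γ y := fun γ hγ ↦ coroot'_pos_of_isPos_of_forall_mem_support b hydom hγ
    constructor
    · intro hβ
      have h1 := hypos _ hβ
      rw [hlev, smul_inv_smul] at h1
      have h2 := (hx₀ i hi).2
      have h3 : ((m i : ℤ) : K) < 1 := by linarith
      have h4 : m i < 1 := by exact_mod_cast h3
      omega
    · intro hmi
      by_contra hβ
      have hβ' : b.IsPos (P.reflectionPerm (g⁻¹ • i) (g⁻¹ • i)) := (RootPairing.Base.IsPos.neg_iff_not b _).mpr hβ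
      have h1 := hypos _ hβ'
      rw [hlev, ← smul_reflectionPerm_self, smul_inv_smul, coroot'_reflectionPerm_self_self_apply, hneg] at h1
      have h2 := (hx₀ i hi).1
      have h3 : ((m i : ℤ) : K) ≤ 0 := by exact_mod_cast hmi
      push_cast at h1
      linarith

end Related

/-! ## §4 «`λ(T(d)w) = Σ_{β∈Δ⁻} (d, wβ) - n(w)`» -/

section LengthOnCone

omit [LinearOrder K] [IsStrictOrderedRing K] [DecidableEq ι] [P.IsCrystallographic] [P.IsReduced] in
/-- ★★ **«`λ(T(d)w) = Σ_{a>0,(a,d)≤0} |(a,d)| + Σ_{a>0,(a,d)>0} (|(a,d)| - 1) = Σ_{β∈Δ⁻} (d, wβ) - n(w)`»** — for `d` related to `g` (the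
minimiser condition) with odd integer levels `m`: `μ(m) + n(g) = -Σ_{γ≻0} m_{gγ}`, `n(g) = Card {γ ≻ 0 | gγ ≺ 0}`, `μ(m) = Σ_{α≻0} (if m_α ≤ 0
then |m_α| else |m_α| - 1)`. Proof: symmetrise the summand of `μ` under `α ↦ -α`, reindex by `α = gγ` (two halvings, row g45-#4
`sum_eq_two_mul_sum_filter_isPos`): for `γ ≻ 0` the symmetrised summand at `gγ` is `-m_{gγ}` if `gγ ≻ 0` and `-m_{gγ} - 1` if `gγ ≺ 0`.
[cite: IwahoriMatsumoto1965, §1.10 (p. 255, "λ(T(d)w) = Σ … = Σ_{β∈Δ⁻}(d, wβ) - n(w)")] -/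
theorem sum_min_add_card_eq_neg_sum [DecidablePred b.IsPos] {m : ι → ℤ} (hms : ∀ i, m (P.reflectionPerm i i) = -m i) {g : P.Aut}
    (hrel : ∀ i, b.IsPos i → (b.IsPos (g⁻¹ • i) ↔ m i ≤ 0)) :
    ∑ i ∈ Finset.univ.filter b.IsPos, (if m i ≤ 0 then |m i| else |m i| - 1) +
        (((Finset.univ.filter b.IsPos).filter (fun i ↦ ¬ b.IsPos (g • i))).card : ℤ) =
      -∑ i ∈ Finset.univ.filter b.IsPos, m (g • i) := by
  -- the symmetrised summand
  set Fs : ι → ℤ := fun i ↦ if b.IsPos i then (if m i ≤ 0 then |m i| else |m i| - 1)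
    else (if m (P.reflectionPerm i i) ≤ 0 then |m (P.reflectionPerm i i)| else |m (P.reflectionPerm i i)| - 1) with hFs
  have hFs_symm : ∀ i, Fs (P.reflectionPerm i i) = Fs i := by
    intro i
    have e1 : b.IsPos (P.reflectionPerm i i) ↔ ¬ b.IsPos i := RootPairing.Base.IsPos.neg_iff_not b i
    simp only [hFs, reflectionPerm_self_self_self]
    by_cases hi : b.IsPos i
    · rw [if_neg (e1.not.mpr (not_not.mpr hi)), if_pos hi]
    · rw [if_pos (e1.mpr hi), if_neg hi]
  -- `Σ_{α≻0} f = Σ_{α≻0} Fs = Σ_{γ≻0} Fs(gγ)`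
  have h1 : ∑ i ∈ Finset.univ.filter b.IsPos, (if m i ≤ 0 then |m i| else |m i| - 1) = ∑ i ∈ Finset.univ.filter b.IsPos, Fs i :=
    Finset.sum_congr rfl fun i hi ↦ by rw [hFs]; dsimp only; rw [if_pos (Finset.mem_filter.mp hi).2]
  have h2 : ∑ i, Fs i = 2 * ∑ i ∈ Finset.univ.filter b.IsPos, Fs i := sum_eq_two_mul_sum_filter_isPos b Fs hFs_symm
  have h3 : ∑ i, Fs (g • i) = ∑ i, Fs i := Equiv.sum_comp (MulAction.toPerm (g : P.Aut)) Fs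
  have h4 : ∑ i, Fs (g • i) = 2 * ∑ i ∈ Finset.univ.filter b.IsPos, Fs (g • i) :=
    sum_eq_two_mul_sum_filter_isPos b _ fun i ↦ by simp only [smul_reflectionPerm_self, hFs_symm]
  -- the value of `Fs(gγ)` for `γ ≻ 0`
  have h5 : ∀ i ∈ Finset.univ.filter b.IsPos, Fs (g • i) = -m (g • i) - (if ¬ b.IsPos (g • i) then 1 else 0) := by
    intro i hi
    have hi' := (Finset.mem_filter.mp hi).2
    rw [hFs]
    dsimp only
    by_cases hpos : b.IsPos (g • i)
    · have hle : m (g • i) ≤ 0 := (hrel (g • i) hpos).mp (by rw [inv_smul_smul]; exact hi')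
      rw [if_pos hpos, if_pos hle, if_neg (not_not.mpr hpos), abs_of_nonpos hle, sub_zero]
    · have hpos' : b.IsPos (P.reflectionPerm (g • i) (g • i)) := (RootPairing.Base.IsPos.neg_iff_not b _).mpr hpos
      have hgt : ¬ m (P.reflectionPerm (g • i) (g • i)) ≤ 0 := by
        intro hle
        have h6 := (hrel _ hpos').mpr hle
        rw [← smul_reflectionPerm_self, inv_smul_smul] at h6
        exact (RootPairing.Base.IsPos.neg_iff_not b i).mp h6 hi'
      rw [if_neg hpos, if_neg hgt, if_pos hpos, hms, abs_of_nonneg (by rw [hms] at hgt; omega)]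
  rw [h1, Finset.card_filter, Nat.cast_sum, ← Finset.sum_neg_distrib]
  have h6 : ∑ i ∈ Finset.univ.filter b.IsPos, Fs i = ∑ i ∈ Finset.univ.filter b.IsPos, Fs (g • i) := by linarith
  rw [h6, ← sub_eq_zero, ← Finset.sum_add_distrib, ← Finset.sum_sub_distrib]
  refine Finset.sum_eq_zero fun i hi ↦ ?_
  rw [h5 i hi]
  push_cast
  ring

end LengthOnCone

/-! ## §5 The cones `Θ(w)`: «`d` is in `Θ(w)` if and only if `δ_1 ≥ 0, …, δ_r ≥ 0, δ_{r+1} > 0, …, δ_l > 0`», and on `Θ(w)`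
`λ(T(d)w) = Σ_i δ_i a_i - n(w)` -/

section Cones

variable {ϖ : b.support → M} (hϖ : ∀ i j : b.support, P.coroot' j (ϖ i) = if i = j then 1 else 0)

include hϖ

omit hϖ [LinearOrder K] [IsStrictOrderedRing K] [Fintype ι] [DecidableEq ι] [CharZero K] [P.IsCrystallographic] [P.IsReduced] in
/-- The levels of `g·(-Σ_j δ_j ϖ_j)` at `gα`: `⟨g(-Σ_j δ_j ϖ_j), (gα)^∨⟩ = -Σ_j δ_j ⟨ϖ_j, α^∨⟩`. [cite: IwahoriMatsumoto1965, §1.10 (p. 256, "δ_i(d) = Σ …")] -/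
theorem coroot'_smul_smul_neg_sum (g : P.Aut) (δ : b.support → ℕ) (i : ι) :
    P.coroot' (g • i) (g • (-(∑ j, (δ j : K) • ϖ j))) = -(∑ j, (δ j : K) * P.coroot' i (ϖ j)) := by
  rw [coroot'_smul_smul, map_neg, map_sum]
  simp_rw [map_smul, smul_eq_mul]

omit [LinearOrder K] [IsStrictOrderedRing K] [Fintype ι] [CharZero K] [P.IsCrystallographic] [P.IsReduced] in
/-- … so at a simple root, `⟨g(-Σ_j δ_j ϖ_j), (gα_j)^∨⟩ = -δ_j` («`δ_i(d) = (d, -wα_i)`»). [cite: IwahoriMatsumoto1965, §1.10 (p. 256)] -/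
theorem coroot'_smul_smul_neg_sum_eq_neg (g : P.Aut) (δ : b.support → ℕ) (j : b.support) :
    P.coroot' (g • (j : ι)) (g • (-(∑ j', (δ j' : K) • ϖ j'))) = -(δ j : K) := by
  rw [coroot'_smul_smul_neg_sum b]
  simp only [hϖ, mul_ite, mul_one, mul_zero, Finset.sum_ite_eq', Finset.mem_univ, if_true]

omit [LinearOrder K] [IsStrictOrderedRing K] [Fintype ι] [P.IsCrystallographic] [P.IsReduced] in
/-- `g·(-Σ_j δ_j ϖ_j)` is a lattice point of `P(Φ)` (the `ϖ_j` are weights, `Aut P` preserves `P(Φ)`). [cite: IwahoriMatsumoto1965, §1.2 ("P, P_r are stable under W")] -/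
theorem smul_neg_sum_mem_weightLattice (g : P.Aut) (δ : b.support → ℕ) :
    g • (-(∑ j, (δ j : K) • ϖ j)) ∈ weightLattice P := by
  refine smul_mem_weightLattice P g (neg_mem (AddSubgroup.sum_mem _ fun j _ ↦ ?_))
  rw [Nat.cast_smul_eq_nsmul]
  exact AddSubgroup.nsmul_mem _ (show ϖ j ∈ weightLattice P from fun k ↦ exists_int_coroot'_fundamental hϖ j k) _

section WithA

variable [Nonempty ι] [DecidablePred b.IsPos] [P.IsRootSystem] {η : ι}
  (hη : ∀ k, P.coroot η - P.coroot k ∈ AddSubmonoid.closure (P.coroot '' (b.support : Set ι)))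
  {a : b.support → ℕ} (ha : ∀ j, (a j : K) = ∑ i ∈ Finset.univ.filter b.IsPos, P.coroot' i (ϖ j))

include ha

omit [Nonempty ι] [P.IsRootSystem] in
/-- ★ `a_j ≥ 1` for the integers `a_j` with `a_j = Σ_{α≻0} ⟨ϖ_j, α^∨⟩` (the summands are `≥ 0` and the one at `α_j` is `1`).
[cite: IwahoriMatsumoto1965, §1.10 (p. 256, "a_1, …, a_l are positive integers")] -/
theorem one_le_of_nat_cast_eq_sum_coroot'_fundamental (j : b.support) : 1 ≤ a j := by
  have hj : (j : ι) ∈ Finset.univ.filter b.IsPos := Finset.mem_filter.mpr ⟨Finset.mem_univ _, b.isPos_of_mem_support j.2⟩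
  have h0 : ∀ i ∈ Finset.univ.filter b.IsPos, (0 : K) ≤ P.coroot' i (ϖ j) := fun i hi ↦
    coroot'_nonneg_of_isPos_of_forall_mem_support b (fun k hk ↦ by rw [hϖ j ⟨k, hk⟩]; split_ifs <;> norm_num) (Finset.mem_filter.mp hi).2
  have h1 := Finset.single_le_sum h0 hj
  rw [hϖ j j, if_pos rfl, ← ha] at h1
  exact_mod_cast h1

include hη

omit [P.IsRootSystem] in
/-- ★★ **«MOREOVER IF `d ∈ Θ(w)`, WE HAVE `λ(T(d)w) = Σ_i δ_i a_i - n(w)`»** — for `d = g·(-Σ_j δ_j ϖ_j)` with `δ_j ≥ 1` whenever `gα_j ≺ 0` and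
`m` its levels: `d` is related to `g` (§3) and `μ(m) + n(g) = Σ_j a_j δ_j` (§4, and `Σ_{γ≻0} ⟨-Σ_j δ_j ϖ_j, γ^∨⟩ = -Σ_j a_j δ_j`).
[cite: IwahoriMatsumoto1965, §1.10 (p. 256, "Moreover if d ∈ Θ(w), we have λ(T(d)w) = Σ_i δ_i a_i - n(w)")] -/
theorem forall_iff_and_sum_min_add_card_eq {g : P.Aut} {δ : b.support → ℕ} (hδ : ∀ j : b.support, ¬ b.IsPos (g • (j : ι)) → 1 ≤ δ j)
    {m : ι → ℤ}
    (hm : ∀ i, P.coroot' i (g • (-(∑ j, (δ j : K) • ϖ j))) = m i) :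
    (∀ i, b.IsPos i → (b.IsPos (g⁻¹ • i) ↔ m i ≤ 0)) ∧
      ∑ i ∈ Finset.univ.filter b.IsPos, (if m i ≤ 0 then |m i| else |m i| - 1) +
          (((Finset.univ.filter b.IsPos).filter (fun i ↦ ¬ b.IsPos (g • i))).card : ℤ) = ∑ j, (a j : ℤ) * δ j := by
  -- the levels at the `gα_j`
  have hmj : ∀ j : b.support, m (g • (j : ι)) = -(δ j : ℤ) := by
    intro j
    have h1 : ((m (g • (j : ι)) : ℤ) : K) = ((-(δ j : ℤ) : ℤ) : K) := by
      rw [← hm, coroot'_smul_smul_neg_sum_eq_neg b hϖ]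
      push_cast
      ring
    exact_mod_cast h1
  have hrel : ∀ i, b.IsPos i → (b.IsPos (g⁻¹ • i) ↔ m i ≤ 0) := by
    refine (forall_isPos_inv_smul_iff_le_iff b hη hm g).mpr fun j hj ↦ ?_
    rw [hmj ⟨j, hj⟩]
    refine ⟨fun _ ↦ by omega, fun hn ↦ ?_⟩
    have := hδ ⟨j, hj⟩ hn
    omega
  refine ⟨hrel, ?_⟩
  rw [sum_min_add_card_eq_neg_sum b (levels_neg hm) hrel]
  -- `-Σ_{γ≻0} m_{gγ} = Σ_j a_j δ_j`, computed in `K`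
  have hK : (((∑ i ∈ Finset.univ.filter b.IsPos, m (g • i) : ℤ)) : K) = -∑ j, (a j : K) * (δ j : K) := by
    push_cast
    rw [Finset.sum_congr rfl fun i _ ↦ ((hm (g • i)).symm.trans (coroot'_smul_smul_neg_sum b g δ i)), Finset.sum_neg_distrib,
      Finset.sum_comm]
    congr 1
    refine Finset.sum_congr rfl fun j _ ↦ ?_
    rw [← Finset.mul_sum, ← ha, mul_comm]
  have h2 : (((-∑ i ∈ Finset.univ.filter b.IsPos, m (g • i) : ℤ)) : K) = (((∑ j, (a j : ℤ) * δ j : ℤ)) : K) := by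
    push_cast at hK ⊢
    rw [hK, neg_neg]
  exact_mod_cast h2

/-- ★★★ **THE CONE `Θ(w)` IS PARAMETRISED BY `δ ∈ ℕ^Δ` WITH `δ_j ≥ 1` FOR `wα_j ≺ 0`, AND `λ = Σ_j a_j δ_j - n(w)` ON IT**: for every `g ∈ Aut P` and
`k`, the lattice points `d ∈ P(Φ)` related to `g` (`∀ α ≻ 0, (g⁻¹α ≻ 0 ↔ ⟨d,α^∨⟩ ≤ 0)`) with `μ(d) = k` are equinumerous — through
`δ ↦ g·(-Σ_j δ_j ϖ_j)`, inverse `δ_j = -⟨g⁻¹d, α_j^∨⟩` («`δ_i(d) = (d, -wα_i)`») — with the `δ ∈ ℕ^Δ`, `δ_j ≥ [gα_j ≺ 0]`, of weight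
`Σ_j a_j δ_j = k + n(g)`. [cite: IwahoriMatsumoto1965, §1.10 (p. 256, "d ∈ P_r^⊥ is in Θ(w) if and only if δ_1 ≥ 0, …, δ_r ≥ 0, δ_{r+1} > 0, …, δ_l > 0 … Moreover if d ∈ Θ(w), we have λ(T(d)w) = Σ δ_i a_i - n(w)")] -/
theorem ncard_related_eq_ncard_cone (g : P.Aut) (k : ℕ) :
    {d : M | d ∈ weightLattice P ∧ ∃ m : ι → ℤ, (∀ i, P.coroot' i d = m i) ∧
        (∀ i, b.IsPos i → (b.IsPos (g⁻¹ • i) ↔ m i ≤ 0)) ∧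
          ∑ i ∈ Finset.univ.filter b.IsPos, (if m i ≤ 0 then |m i| else |m i| - 1) = k}.ncard =
      {δ : b.support → ℕ | (∀ j : b.support, (if b.IsPos (g • (j : ι)) then 0 else 1) ≤ δ j) ∧
        ∑ j, a j * δ j = k + ((Finset.univ.filter b.IsPos).filter (fun i ↦ ¬ b.IsPos (g • i))).card}.ncard := by
  symm
  refine Set.ncard_congr (fun δ _ ↦ g • (-(∑ j, (δ j : K) • ϖ j))) ?_ ?_ ?_
  · -- well defined
    rintro δ ⟨hδ, hwt⟩
    have hδ' : ∀ j : b.support, ¬ b.IsPos (g • (j : ι)) → 1 ≤ δ j := fun j hj ↦ by have := hδ j; rwa [if_neg hj] at this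
    have hd := smul_neg_sum_mem_weightLattice b hϖ g δ
    obtain ⟨m, hm, -⟩ := exists_coroot'_eq_intCast_of_mem_weightLattice hd
    obtain ⟨hrel, hμ⟩ := forall_iff_and_sum_min_add_card_eq b hϖ hη ha hδ' hm
    refine ⟨hd, m, hm, hrel, ?_⟩
    have hwt' : (∑ j, (a j : ℤ) * (δ j : ℤ)) = (((k + ((Finset.univ.filter b.IsPos).filter (fun i ↦ ¬ b.IsPos (g • i))).card : ℕ)) : ℤ) := by
      exact_mod_cast hwt
    push_cast at hwt'
    omega
  · -- injective
    rintro δ δ' - - h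
    have h1 : (∑ j, (δ j : K) • ϖ j) = ∑ j, (δ' j : K) • ϖ j := neg_injective (MulAction.injective g h)
    funext j
    have h2 := congrArg (P.coroot' (j : ι)) h1
    rw [map_sum, map_sum] at h2
    simp_rw [map_smul, smul_eq_mul] at h2
    simp only [hϖ, mul_ite, mul_one, mul_zero, Finset.sum_ite_eq', Finset.mem_univ, if_true] at h2
    exact_mod_cast h2
  · -- surjective: `δ_j = -⟨g⁻¹d, α_j^∨⟩`
    rintro d ⟨hd, m, hm, hrel, hμ⟩
    have hsimple := (forall_isPos_inv_smul_iff_le_iff b hη hm g).mp hrel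
    have hnonpos : ∀ j : b.support, m (g • (j : ι)) ≤ 0 := fun j ↦ by
      by_cases h : b.IsPos (g • (j : ι))
      · exact (hsimple j j.2).1 h
      · have := (hsimple j j.2).2 h; omega
    set δ : b.support → ℕ := fun j ↦ (-m (g • (j : ι))).toNat with hδdef
    have hδ : ∀ j : b.support, ((δ j : ℕ) : ℤ) = -m (g • (j : ι)) := fun j ↦ Int.toNat_of_nonneg (by have := hnonpos j; omega)
    -- `d = g·(-Σ_j δ_j ϖ_j)`
    have hdeq : g • (-(∑ j, (δ j : K) • ϖ j)) = d := by
      rw [← smul_inv_smul g d]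
      congr 1
      rw [eq_sum_coroot'_smul hϖ (g⁻¹ • d), ← Finset.sum_neg_distrib]
      refine Finset.sum_congr rfl fun j _ ↦ ?_
      rw [← neg_smul]
      congr 1
      rw [← coroot'_smul_smul g (j : ι) (g⁻¹ • d), smul_inv_smul, hm]
      have h1 : ((m (g • (j : ι)) : ℤ) : K) = ((-(δ j : ℤ) : ℤ) : K) := by rw [hδ j, neg_neg]
      push_cast at h1
      exact h1.symm
    have hδ1 : ∀ j : b.support, ¬ b.IsPos (g • (j : ι)) → 1 ≤ δ j := fun j hj ↦ by
      have h1 := (hsimple j j.2).2 hj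
      have h2 := hδ j
      omega
    refine ⟨δ, ⟨fun j ↦ ?_, ?_⟩, hdeq⟩
    · by_cases h : b.IsPos (g • (j : ι))
      · rw [if_pos h]; exact Nat.zero_le _
      · rw [if_neg h]; exact hδ1 j h
    · have hm' : ∀ i, P.coroot' i (g • (-(∑ j, (δ j : K) • ϖ j))) = m i := fun i ↦ by rw [hdeq]; exact hm i
      obtain ⟨-, hμ'⟩ := forall_iff_and_sum_min_add_card_eq b hϖ hη ha hδ1 hm'
      rw [hμ] at hμ'
      exact_mod_cast hμ'.symm

omit hϖ ha in
/-- ★★ **`P(Φ) = ⊔_{w∈W} Θ(w)`, COUNTED** («`DW` is a disjoint union of the subsets `Θ'(w)W`»; every `d` is related to exactly one `w ∈ W`,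
Proposition 1.25 — rows g45-#14 `exists_weylGroup_forall_isPos_inv_smul_iff_le`, `weylGroup_unique_of_forall_isPos_inv_smul_iff`): for a finite
set `W` enumerating the Weyl group, `Card {d ∈ P(Φ) | μ(d) = k} = Σ_{g∈W} Card {d ∈ P(Φ) related to g | μ(d) = k}`.
[cite: IwahoriMatsumoto1965, §1.10 (p. 257, "Since DW is a disjoint union of the subsets Θ′(w)W") and §1.9 Proposition 1.25] -/
theorem ncard_weightLattice_sum_min_eq_sum_ncard_related (W : Finset P.Aut) (hW : ∀ g, g ∈ W ↔ g ∈ P.weylGroup) (k : ℕ) :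
    {d : M | d ∈ weightLattice P ∧ ∃ m : ι → ℤ, (∀ i, P.coroot' i d = m i) ∧
        ∑ i ∈ Finset.univ.filter b.IsPos, (if m i ≤ 0 then |m i| else |m i| - 1) = k}.ncard =
      ∑ g ∈ W, {d : M | d ∈ weightLattice P ∧ ∃ m : ι → ℤ, (∀ i, P.coroot' i d = m i) ∧
        (∀ i, b.IsPos i → (b.IsPos (g⁻¹ • i) ↔ m i ≤ 0)) ∧
          ∑ i ∈ Finset.univ.filter b.IsPos, (if m i ≤ 0 then |m i| else |m i| - 1) = k}.ncard := by
  classical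
  have hfin : ∀ g : P.Aut, ({d : M | d ∈ weightLattice P ∧ ∃ m : ι → ℤ, (∀ i, P.coroot' i d = m i) ∧
      (∀ i, b.IsPos i → (b.IsPos (g⁻¹ • i) ↔ m i ≤ 0)) ∧
        ∑ i ∈ Finset.univ.filter b.IsPos, (if m i ≤ 0 then |m i| else |m i| - 1) = k}).Finite := fun g ↦
    (finite_weightLattice_sum_min_eq b (k : ℤ)).subset fun d ⟨hd, m, hm, _, hμ⟩ ↦ ⟨hd, m, hm, hμ⟩
  have hmuniq : ∀ d : M, ∀ m m' : ι → ℤ, (∀ i, P.coroot' i d = m i) → (∀ i, P.coroot' i d = m' i) → m = m' := fun d m m' hm hm' ↦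
    funext fun i ↦ by have h1 := (hm i).symm.trans (hm' i); exact_mod_cast h1
  have heq : {d : M | d ∈ weightLattice P ∧ ∃ m : ι → ℤ, (∀ i, P.coroot' i d = m i) ∧
      ∑ i ∈ Finset.univ.filter b.IsPos, (if m i ≤ 0 then |m i| else |m i| - 1) = k} = ↑(W.biUnion fun g ↦ (hfin g).toFinset) := by
    ext d
    simp only [Set.mem_setOf_eq, Finset.coe_biUnion, Finset.mem_coe, Set.mem_iUnion, Set.Finite.coe_toFinset, exists_prop]
    constructor
    · rintro ⟨hd, m, hm, hμ⟩
      obtain ⟨g, hg, hrel⟩ := exists_weylGroup_forall_isPos_inv_smul_iff_le b hη hm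
      exact ⟨g, (hW g).mpr hg, hd, m, hm, hrel, hμ⟩
    · rintro ⟨g, -, hd, m, hm, -, hμ⟩
      exact ⟨hd, m, hm, hμ⟩
  rw [heq, Set.ncard_coe_finset, Finset.card_biUnion]
  · exact Finset.sum_congr rfl fun g _ ↦ (Set.ncard_eq_toFinset_card _ (hfin g)).symm
  · intro g hg g' hg' hne
    rw [Function.onFun, Finset.disjoint_left]
    intro d h1 h2
    rw [Set.Finite.mem_toFinset] at h1 h2
    obtain ⟨-, m, hm, hrel, -⟩ := h1
    obtain ⟨-, m', hm', hrel', -⟩ := h2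
    have hmm := hmuniq d m m' hm hm'
    subst hmm
    exact hne (weylGroup_unique_of_forall_isPos_inv_smul_iff b ((hW g).mp hg) ((hW g').mp hg') hrel hrel')

end WithA

end Cones

/-! ## §6 «`Σ_{d∈Θ(w)} t^{λ(T(d)w)} = t^{a(w)-n(w)} / Π_i (1 - t^{a_i})`» and the lattice series -/

section Assembly

variable {ϖ : b.support → M} (hϖ : ∀ i j : b.support, P.coroot' j (ϖ i) = if i = j then 1 else 0)
  [Nonempty ι] [DecidablePred b.IsPos] [P.IsRootSystem] {η : ι}
  (hη : ∀ k, P.coroot η - P.coroot k ∈ AddSubmonoid.closure (P.coroot '' (b.support : Set ι)))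
  {a : b.support → ℕ} (ha : ∀ j, (a j : K) = ∑ i ∈ Finset.univ.filter b.IsPos, P.coroot' i (ϖ j))

include hϖ hη ha

omit [P.IsRootSystem] in
/-- ★ **`n(w) ≤ a(w)`** where `a(g) := Σ_{j : gα_j ≺ 0} a_j` («`a(w) = Σ_{α_i ∈ Π ∩ w⁻¹Δ⁻} a_i`») and `n(g) = Card {α ≻ 0 | gα ≺ 0}`: `a(g) - n(g)` is
the value of `μ ≥ 0` at the corner `d = g·(-Σ_{gα_j≺0} ϖ_j)` of the cone. [cite: IwahoriMatsumoto1965, §1.10 (p. 256, "a(w) = Σ_{α_i∈Π∩w⁻¹Δ⁻} a_i")] -/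
theorem card_filter_le_sum_mul_ite (g : P.Aut) :
    ((Finset.univ.filter b.IsPos).filter (fun i ↦ ¬ b.IsPos (g • i))).card ≤ ∑ j, a j * (if b.IsPos (g • (j : ι)) then 0 else 1) := by
  set δ : b.support → ℕ := fun j ↦ if b.IsPos (g • (j : ι)) then 0 else 1 with hδdef
  have hδ : ∀ j : b.support, ¬ b.IsPos (g • (j : ι)) → 1 ≤ δ j := fun j hj ↦ by simp only [hδdef]; rw [if_neg hj]
  obtain ⟨m, hm, -⟩ := exists_coroot'_eq_intCast_of_mem_weightLattice (smul_neg_sum_mem_weightLattice b hϖ g δ)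
  obtain ⟨-, hμ⟩ := forall_iff_and_sum_min_add_card_eq b hϖ hη ha hδ hm
  have h0 : (0 : ℤ) ≤ ∑ i ∈ Finset.univ.filter b.IsPos, (if m i ≤ 0 then |m i| else |m i| - 1) :=
    Finset.sum_nonneg fun i _ ↦ summand_min_nonneg (m i)
  have h1 : ((((Finset.univ.filter b.IsPos).filter (fun i ↦ ¬ b.IsPos (g • i))).card : ℕ) : ℤ) ≤ ((∑ j, a j * δ j : ℕ) : ℤ) := by
    push_cast
    linarith
  exact_mod_cast h1

/-- ★★★ **«`Σ_{d∈Θ(w)} t^{λ(T(d)w)} = t^{-n(w)} Σ_{δ} t^{a_1δ_1+⋯+a_lδ_l} = t^{a(w)-n(w)} / Π_{i=1}^{l} (1 - t^{a_i})`»**, multiplied out in `ℤ⟦t⟧`: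
for every `g ∈ Aut P`, `(Π_j (1 - t^{a_j})) · Σ_k Card {d ∈ P(Φ) related to g | μ(d) = k} t^k = t^{a(g) - n(g)}` (§5 and the cone series §1;
`a(g) ≥ n(g)` by the previous lemma). [cite: IwahoriMatsumoto1965, §1.10 (p. 256)] -/
theorem prod_one_sub_X_pow_mul_mk_ncard_related (g : P.Aut) :
    (∏ j, (1 - (X : PowerSeries ℤ) ^ a j)) *
        PowerSeries.mk (fun k ↦ ({d : M | d ∈ weightLattice P ∧ ∃ m : ι → ℤ, (∀ i, P.coroot' i d = m i) ∧
          (∀ i, b.IsPos i → (b.IsPos (g⁻¹ • i) ↔ m i ≤ 0)) ∧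
            ∑ i ∈ Finset.univ.filter b.IsPos, (if m i ≤ 0 then |m i| else |m i| - 1) = k}.ncard : ℤ)) =
      X ^ (∑ j, a j * (if b.IsPos (g • (j : ι)) then 0 else 1) - ((Finset.univ.filter b.IsPos).filter (fun i ↦ ¬ b.IsPos (g • i))).card) := by
  set n : ℕ := ((Finset.univ.filter b.IsPos).filter (fun i ↦ ¬ b.IsPos (g • i))).card with hn
  set e : b.support → ℕ := fun j ↦ if b.IsPos (g • (j : ι)) then 0 else 1 with he
  have ha1 : ∀ j, 1 ≤ a j := one_le_of_nat_cast_eq_sum_coroot'_fundamental b hϖ ha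
  -- no cone point has weight `< n(g)` (`μ ≥ 0`)
  have hempty : ∀ k' < n, {δ : b.support → ℕ | (∀ j : b.support, e j ≤ δ j) ∧ ∑ j, a j * δ j = k'} = ∅ := by
    intro k' hk'
    ext δ
    simp only [Set.mem_setOf_eq, Set.mem_empty_iff_false, iff_false, not_and]
    intro hδe hwt
    have hδ : ∀ j : b.support, ¬ b.IsPos (g • (j : ι)) → 1 ≤ δ j := fun j hj ↦ by have := hδe j; simp only [he] at this; rwa [if_neg hj] at this
    obtain ⟨m, hm, -⟩ := exists_coroot'_eq_intCast_of_mem_weightLattice (smul_neg_sum_mem_weightLattice b hϖ g δ)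
    obtain ⟨-, hμ⟩ := forall_iff_and_sum_min_add_card_eq b hϖ hη ha hδ hm
    have h0 : (0 : ℤ) ≤ ∑ i ∈ Finset.univ.filter b.IsPos, (if m i ≤ 0 then |m i| else |m i| - 1) :=
      Finset.sum_nonneg fun i _ ↦ summand_min_nonneg (m i)
    have h1 : (∑ j, (a j : ℤ) * δ j) = k' := by exact_mod_cast hwt
    rw [h1, ← hn] at hμ
    omega
  -- the cone series is `t^{n(g)}` times the `Θ` series
  have hC : PowerSeries.mk (fun k' ↦ ({δ : b.support → ℕ | (∀ j : b.support, e j ≤ δ j) ∧ ∑ j, a j * δ j = k'}.ncard : ℤ)) =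
      X ^ n * PowerSeries.mk (fun k ↦ ({d : M | d ∈ weightLattice P ∧ ∃ m : ι → ℤ, (∀ i, P.coroot' i d = m i) ∧
          (∀ i, b.IsPos i → (b.IsPos (g⁻¹ • i) ↔ m i ≤ 0)) ∧
            ∑ i ∈ Finset.univ.filter b.IsPos, (if m i ≤ 0 then |m i| else |m i| - 1) = k}.ncard : ℤ)) := by
    ext k'
    rw [coeff_mk, coeff_X_pow_mul']
    split_ifs with hle
    · rw [coeff_mk, ncard_related_eq_ncard_cone b hϖ hη ha g (k' - n), ← hn, Nat.sub_add_cancel hle]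
    · rw [hempty k' (by omega), Set.ncard_empty, Nat.cast_zero]
  have hcone := prod_one_sub_X_pow_mul_mk_ncard_cone a e ha1
  rw [hC, mul_left_comm] at hcone
  -- `a(g) ≥ n(g)` and cancel `t^{n(g)}`
  have hle : n ≤ ∑ j, a j * e j := card_filter_le_sum_mul_ite b hϖ hη ha g
  refine eq_of_X_pow_mul_eq n ?_
  rw [hcone, ← pow_add, Nat.add_sub_cancel' hle]

/-- ★★★ **THE LATTICE SERIES IN CLOSED FORM: `(Π_j (1 - t^{a_j})) · Σ_{d∈P(Φ)} t^{μ(d)} = Σ_{w∈W} t^{a(w)-n(w)}`** — IM's computation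
«`Σ_{σ∈Γ} t^{λ(σ)} = Σ_{w∈W} t^{a(w)-n(w)} / Π_{i=1}^{l}(1 - t^{a_i})`» for the minimal representatives `Γ = ⋃_w Θ'(w) ↔ P(Φ)` of `DW/W`,
multiplied out: sum §6 over the cones `Θ(w)`, `w ∈ W` (§5 partition); `W` any finite set enumerating the Weyl group,
`a(g) = Σ_{gα_j≺0} a_j`, `n(g) = Card {α ≻ 0 | gα ≺ 0}`. [cite: IwahoriMatsumoto1965, §1.10 (pp. 256–257)] -/
theorem prod_one_sub_X_pow_mul_mk_ncard_weightLattice (W : Finset P.Aut) (hW : ∀ g, g ∈ W ↔ g ∈ P.weylGroup) :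
    (∏ j, (1 - (X : PowerSeries ℤ) ^ a j)) *
        PowerSeries.mk (fun k ↦ ({d : M | d ∈ weightLattice P ∧ ∃ m : ι → ℤ, (∀ i, P.coroot' i d = m i) ∧
          ∑ i ∈ Finset.univ.filter b.IsPos, (if m i ≤ 0 then |m i| else |m i| - 1) = k}.ncard : ℤ)) =
      ∑ g ∈ W, (X : PowerSeries ℤ) ^
        (∑ j, a j * (if b.IsPos (g • (j : ι)) then 0 else 1) - ((Finset.univ.filter b.IsPos).filter (fun i ↦ ¬ b.IsPos (g • i))).card) := by
  have h1 : PowerSeries.mk (fun k ↦ ({d : M | d ∈ weightLattice P ∧ ∃ m : ι → ℤ, (∀ i, P.coroot' i d = m i) ∧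
      ∑ i ∈ Finset.univ.filter b.IsPos, (if m i ≤ 0 then |m i| else |m i| - 1) = k}.ncard : ℤ)) =
        ∑ g ∈ W, PowerSeries.mk (fun k ↦ ({d : M | d ∈ weightLattice P ∧ ∃ m : ι → ℤ, (∀ i, P.coroot' i d = m i) ∧
          (∀ i, b.IsPos i → (b.IsPos (g⁻¹ • i) ↔ m i ≤ 0)) ∧
            ∑ i ∈ Finset.univ.filter b.IsPos, (if m i ≤ 0 then |m i| else |m i| - 1) = k}.ncard : ℤ)) := by
    ext k
    rw [coeff_mk, map_sum, ncard_weightLattice_sum_min_eq_sum_ncard_related b hη W hW k, Nat.cast_sum]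
    exact Finset.sum_congr rfl fun g _ ↦ by rw [coeff_mk]
  rw [h1, Finset.mul_sum]
  exact Finset.sum_congr rfl fun g _ ↦ prod_one_sub_X_pow_mul_mk_ncard_related b hϖ hη ha g

end Assembly

/-! ## §7 PROPOSITION 1.30: `P(DW, t)` and `P(D'W, t)` -/

section Proposition130

include b in
omit [LinearOrder K] [IsStrictOrderedRing K] [DecidableEq ι] in
/-- ★ A finite set enumerating the Weyl group exists (`W` is finite, tree `finite_weylGroup`). [cite: Humphreys1990, §1.1 ("finite reflection groups")] -/
theorem exists_finset_forall_mem_iff_mem_weylGroup : ∃ W : Finset P.Aut, ∀ g, g ∈ W ↔ g ∈ P.weylGroup := by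
  haveI : Finite P.weylGroup := finite_weylGroup b
  have hfin : (P.weylGroup : Set P.Aut).Finite := Set.toFinite _
  exact ⟨hfin.toFinset, fun g ↦ by rw [Set.Finite.mem_toFinset, SetLike.mem_coe]⟩

omit [LinearOrder K] [IsStrictOrderedRing K] [DecidableEq ι] in
/-- ★★ **«`P(W, t) = Σ_{w′∈W} t^{n(w′)}`»**: the series `Σ_j Card {g ∈ W | ℓ_W(g) = j} t^j` (word length in the simple reflections, row g36-#5
`ℓ_W = n`) is the polynomial `Σ_{g∈W} t^{n(g)}` over any finite set enumerating `W`. [cite: IwahoriMatsumoto1965, §1.10 (p. 257, "where P(W, t) = Σ_{w′∈W} t^{n(w′)}") and §1.9 Corollary 1.24] -/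
theorem mk_ncard_length_weylGroup_eq_sum [DecidablePred b.IsPos] (W : Finset P.Aut) (hW : ∀ g, g ∈ W ↔ g ∈ P.weylGroup) :
    PowerSeries.mk (fun j ↦ ({g : P.weylGroup |
        PreCoxeterSystem.length (fun j : b.support ↦ RootPairing.weylGroup.ofIdx P (j : ι)) g = j}.ncard : ℤ)) =
      ∑ g ∈ W, (X : PowerSeries ℤ) ^ ((Finset.univ.filter b.IsPos).filter (fun i ↦ ¬ b.IsPos (g • i))).card := by
  ext j
  rw [coeff_mk, map_sum]
  simp_rw [coeff_X_pow]
  rw [Finset.sum_boole]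
  -- the set in the subtype `W` and the filter of the finset `W`
  have h1 : {g : P.weylGroup | PreCoxeterSystem.length (fun j : b.support ↦ RootPairing.weylGroup.ofIdx P (j : ι)) g = j}.ncard =
      (W.filter (fun g ↦ j = ((Finset.univ.filter b.IsPos).filter (fun i ↦ ¬ b.IsPos (g • i))).card)).card := by
    rw [← Set.ncard_coe_finset, ← Set.ncard_image_of_injective _ Subtype.val_injective]
    congr 1
    ext g
    simp only [Set.mem_image, Set.mem_setOf_eq, Finset.coe_filter, Subtype.exists, exists_and_right, exists_eq_right]
    constructor
    · rintro ⟨hg, hlen⟩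
      refine ⟨(hW g).mpr hg, ?_⟩
      rw [← hlen, length_weylGroup_eq_card_filter b ⟨g, hg⟩]
    · rintro ⟨hgW, hj⟩
      refine ⟨(hW g).mp hgW, ?_⟩
      rw [hj, length_weylGroup_eq_card_filter b ⟨g, (hW g).mp hgW⟩]
  rw [h1]

/-- Base change `ℕ⟦t⟧ → ℤ⟦t⟧` of a series of counts. [cite: IwahoriMatsumoto1965, §1.10] -/
private theorem map_mk_natCast (f : ℕ → ℕ) :
    PowerSeries.map (Nat.castRingHom ℤ) (PowerSeries.mk f) = PowerSeries.mk (fun n ↦ (f n : ℤ)) := by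
  ext n
  rw [coeff_map, coeff_mk, coeff_mk, Nat.coe_castRingHom]

variable {ϖ : b.support → M} (hϖ : ∀ i j : b.support, P.coroot' j (ϖ i) = if i = j then 1 else 0)
  [Nonempty ι] [DecidablePred b.IsPos] [P.IsRootSystem] {η : ι}
  (hη : ∀ k, P.coroot η - P.coroot k ∈ AddSubmonoid.closure (P.coroot '' (b.support : Set ι)))
  {a : b.support → ℕ} (ha : ∀ j, (a j : K) = ∑ i ∈ Finset.univ.filter b.IsPos, P.coroot' i (ϖ j))

include hϖ hη ha

/-- ★★★ **IWAHORI–MATSUMOTO PROPOSITION 1.30, FIRST FORMULA: «`P(DW, t) = P(W, t) · Σ_{w∈W} t^{a(w)-n(w)} / Π_{i=1}^{l} (1 - t^{a_i})`»** for the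
EXTENDED group `DW = Ŵ_a`, multiplied out in `ℤ⟦t⟧`: `(Π_j (1 - t^{a_j})) · Ŵ_a(t) = (Σ_{g∈W} t^{n(g)}) · Σ_{g∈W} t^{a(g)-n(g)}`, where
`Ŵ_a(t) = Σ_n Card {σ ∈ Ŵ_a | λ(σ) = n} t^n` (`λ(σ)` = the number of hyperplanes separating `A∘` from `σA∘`, as `Σ_α |k_α - k∘_α| = 2n`),
`a_j = ⟨ϖ_j, Σ_{α≻0} α^∨⟩` («`Σ_{α∈Δ⁺} α = a_1α_1 + ⋯ + a_lα_l`»), `a(g) = Σ_{gα_j ≺ 0} a_j` («`a(w) = Σ_{α_i∈Π∩w⁻¹Δ⁻} a_i`»), `n(g) = Card {α ≻ 0 |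
gα ≺ 0}`; from row g47-#8 (`Ŵ_a(t) = W(t)·Σ_{d∈P(Φ)} t^{μ(d)}`) and §6. [cite: IwahoriMatsumoto1965, §1.10 Proposition 1.30 (p. 257)] [cite: Bott1956, §§9, 15 (cite-only, via IM §1.10 "cf. Bott [2, §§ 9, 15]")] -/
theorem prod_one_sub_X_pow_mul_mk_ncard_extendedAffineWeylGroup (W : Finset P.Aut) (hW : ∀ g, g ∈ W ↔ g ∈ P.weylGroup) :
    (∏ j, (1 - (X : PowerSeries ℤ) ^ a j)) *
        PowerSeries.mk (fun n ↦ ({σ : M ≃ᵃ[K] M | σ ∈ extendedAffineWeylGroup P ∧ ∃ k : ι → ℤ,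
          σ '' {x : M | ∀ i, b.IsPos i → 0 < P.coroot' i x ∧ P.coroot' i x < 1} = alcove P k ∧
            ∑ i, |k i - (if b.IsPos i then (0 : ℤ) else -1)| = 2 * n}.ncard : ℤ)) =
      (∑ g ∈ W, (X : PowerSeries ℤ) ^ ((Finset.univ.filter b.IsPos).filter (fun i ↦ ¬ b.IsPos (g • i))).card) *
        ∑ g ∈ W, (X : PowerSeries ℤ) ^
          (∑ j, a j * (if b.IsPos (g • (j : ι)) then 0 else 1) - ((Finset.univ.filter b.IsPos).filter (fun i ↦ ¬ b.IsPos (g • i))).card) := by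
  have h1 := congrArg (PowerSeries.map (Nat.castRingHom ℤ)) (mk_ncard_extendedAffineWeylGroup_eq_mul b hη)
  rw [map_mul, map_mk_natCast, map_mk_natCast, map_mk_natCast, mk_ncard_length_weylGroup_eq_sum b W hW] at h1
  rw [h1, mul_left_comm, prod_one_sub_X_pow_mul_mk_ncard_weightLattice b hϖ hη ha W hW]

/-- ★★★ **IWAHORI–MATSUMOTO PROPOSITION 1.30, SECOND FORMULA: «`P(D'W, t) = P(W, t) · Σ_{w∈W} t^{a(w)-n(w)} / (|Ω| Π_{i=1}^{l} (1 - t^{a_i}))`»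
— THE POINCARÉ SERIES OF THE AFFINE WEYL GROUP `W_a = D'W` IN CLOSED FORM**, multiplied out in `ℤ⟦t⟧` with `|Ω| = |det C|` (row g47-#6):
`|det C| · (Π_j (1 - t^{a_j})) · W_a(t) = (Σ_{g∈W} t^{n(g)}) · Σ_{g∈W} t^{a(g)-n(g)}`, `W_a(t)` the Poincaré series (p13) of the Coxeter system of
row g45-#1 (`cs`, simple reflections = the walls of `A∘`); from the first formula and `Ŵ_a(t) = |Ω|·W_a(t)` (row g47-#3).
[cite: IwahoriMatsumoto1965, §1.10 Proposition 1.30 (p. 257)] [cite: Humphreys1990, §8.9 (pp. 179–180, Bott's formula)] [cite: Bott1956, §§9, 15 (cite-only)] -/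
theorem natAbs_det_smul_prod_one_sub_X_pow_mul_poincareSeries_affineWeylGroup {M' : CoxeterMatrix (Option b.support)}
    (cs : CoxeterSystem M' (affineWeylGroup P)) (hcs : ∀ o, cs.simple o = wallReflection b η o)
    (W : Finset P.Aut) (hW : ∀ g, g ∈ W ↔ g ∈ P.weylGroup) :
    b.cartanMatrix.det.natAbs • ((∏ j, (1 - (X : PowerSeries ℤ) ^ a j)) * poincareSeries cs ℤ (Set.univ : Set (affineWeylGroup P))) =
      (∑ g ∈ W, (X : PowerSeries ℤ) ^ ((Finset.univ.filter b.IsPos).filter (fun i ↦ ¬ b.IsPos (g • i))).card) *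
        ∑ g ∈ W, (X : PowerSeries ℤ) ^
          (∑ j, a j * (if b.IsPos (g • (j : ι)) then 0 else 1) - ((Finset.univ.filter b.IsPos).filter (fun i ↦ ¬ b.IsPos (g • i))).card) := by
  have h1 := congrArg (PowerSeries.map (Nat.castRingHom ℤ)) (mk_ncard_extendedAffineWeylGroup_eq_smul b cs hcs hη)
  rw [map_nsmul, map_mk_natCast, natCard_stabilizer_eq_natAbs_det b hϖ hη] at h1
  have h2 : PowerSeries.map (Nat.castRingHom ℤ) (poincareSeries cs ℕ (Set.univ : Set (affineWeylGroup P))) =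
      poincareSeries cs ℤ (Set.univ : Set (affineWeylGroup P)) := by
    ext n
    rw [coeff_map, coeff_poincareSeries_univ, coeff_poincareSeries_univ, Nat.cast_id, Nat.coe_castRingHom]
  rw [h2] at h1
  rw [← prod_one_sub_X_pow_mul_mk_ncard_extendedAffineWeylGroup b hϖ hη ha W hW, h1, mul_smul_comm]

/-- ★★ **THE ROOT-LATTICE SERIES IN CLOSED FORM: `|det C| · (Π_j (1 - t^{a_j})) · Σ_{d∈Q} t^{μ(d)} = Σ_{w∈W} t^{a(w)-n(w)}`** — the Poincaré series
of the distinguished representatives `W^I ↔ Q` of `W_a/W` («the Poincaré series of `L(Φ^∨)` viewed as a subgroup of the affine Weyl group», row g47-#3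
`W^I(t) = Σ_{d∈Q} t^{μ(d)}`), from §6 and `Σ_{d∈P(Φ)} t^{μ(d)} = |Ω|·Σ_{d∈Q} t^{μ(d)}` (row g47-#8), `|Ω| = |det C|` (row g47-#6).
[cite: IwahoriMatsumoto1965, §1.10 Proposition 1.30 ("P(D′W, t) = P(W, t) Σ_{w∈W} t^{a(w)-n(w)} / (|Ω| Π (1 - t^{a_i}))")] [cite: Humphreys1990, §8.9 ("the Poincaré series of L(Φ^∨) (viewed as a subgroup of the affine Weyl group W_a)")] -/
theorem natAbs_det_smul_prod_one_sub_X_pow_mul_mk_ncard_rootSpan (W : Finset P.Aut) (hW : ∀ g, g ∈ W ↔ g ∈ P.weylGroup) :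
    b.cartanMatrix.det.natAbs • ((∏ j, (1 - (X : PowerSeries ℤ) ^ a j)) *
        PowerSeries.mk (fun k ↦ ({d : M | d ∈ P.rootSpan ℤ ∧ ∃ m : ι → ℤ, (∀ i, P.coroot' i d = m i) ∧
          ∑ i ∈ Finset.univ.filter b.IsPos, (if m i ≤ 0 then |m i| else |m i| - 1) = k}.ncard : ℤ))) =
      ∑ g ∈ W, (X : PowerSeries ℤ) ^
        (∑ j, a j * (if b.IsPos (g • (j : ι)) then 0 else 1) - ((Finset.univ.filter b.IsPos).filter (fun i ↦ ¬ b.IsPos (g • i))).card) := by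
  have hPQ : PowerSeries.mk (fun k ↦ ({d : M | d ∈ weightLattice P ∧ ∃ m : ι → ℤ, (∀ i, P.coroot' i d = m i) ∧
      ∑ i ∈ Finset.univ.filter b.IsPos, (if m i ≤ 0 then |m i| else |m i| - 1) = k}.ncard : ℤ)) =
        b.cartanMatrix.det.natAbs • PowerSeries.mk (fun k ↦ ({d : M | d ∈ P.rootSpan ℤ ∧ ∃ m : ι → ℤ, (∀ i, P.coroot' i d = m i) ∧
          ∑ i ∈ Finset.univ.filter b.IsPos, (if m i ≤ 0 then |m i| else |m i| - 1) = k}.ncard : ℤ)) := by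
    ext k
    rw [coeff_mk, map_nsmul, coeff_mk, ncard_weightLattice_sum_min_eq_mul b hη k, natCard_stabilizer_eq_natAbs_det b hϖ hη, Nat.cast_mul,
      nsmul_eq_mul]
  rw [← mul_smul_comm, ← hPQ, prod_one_sub_X_pow_mul_mk_ncard_weightLattice b hϖ hη ha W hW]

/-- ★★ **COROLLARY (THE CONSTANT TERMS OF PROPOSITION 1.30): `Card {w ∈ W | a(w) = n(w)} = |det C|`** (`= |Ω| = [P(Φ) : Q]`, Corollary
1.19): at `t = 0` the second formula reads `|det C| · 1 · 1 = 1 · Card {w | a(w) - n(w) = 0}` (`a_j ≥ 1`; only `w = 1` has length `0` in `W_a` and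
in `W`; `n(w) ≤ a(w)`). [cite: IwahoriMatsumoto1965, §1.10 Proposition 1.30 (p. 257) and §1.7 Corollary 1.19 ("the order of the group Ω (i.e. the index [P : P_r])")] -/
theorem card_filter_sum_mul_ite_eq_card_eq_natAbs_det {M' : CoxeterMatrix (Option b.support)}
    (cs : CoxeterSystem M' (affineWeylGroup P)) (hcs : ∀ o, cs.simple o = wallReflection b η o)
    (W : Finset P.Aut) (hW : ∀ g, g ∈ W ↔ g ∈ P.weylGroup) :
    (W.filter (fun g ↦ ∑ j, a j * (if b.IsPos (g • (j : ι)) then 0 else 1) =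
        ((Finset.univ.filter b.IsPos).filter (fun i ↦ ¬ b.IsPos (g • i))).card)).card = b.cartanMatrix.det.natAbs := by
  have h := congrArg constantCoeff (natAbs_det_smul_prod_one_sub_X_pow_mul_poincareSeries_affineWeylGroup b hϖ hη ha cs hcs W hW)
  have ha1 := one_le_of_nat_cast_eq_sum_coroot'_fundamental b hϖ ha
  -- constant terms on the left: `|det C| · 1 · 1`
  have h1 : constantCoeff (∏ j, (1 - (X : PowerSeries ℤ) ^ a j)) = 1 := by
    rw [map_prod]
    refine Finset.prod_eq_one fun j _ ↦ ?_
    rw [map_sub, map_one, map_pow, constantCoeff_X, zero_pow (by have := ha1 j; omega), sub_zero]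
  have h2 : constantCoeff (poincareSeries cs ℤ (Set.univ : Set (affineWeylGroup P))) = 1 := by
    rw [← coeff_zero_eq_constantCoeff_apply, coeff_poincareSeries_univ]
    have h5 : {w : affineWeylGroup P | cs.length w = 0} = {1} := by
      ext w
      rw [Set.mem_setOf_eq, Set.mem_singleton_iff, cs.length_eq_zero_iff]
    rw [h5, Set.ncard_singleton, Nat.cast_one]
  -- … and on the right: `1 · Card {w | a(w) = n(w)}`
  have h3 : constantCoeff (∑ g ∈ W, (X : PowerSeries ℤ) ^ ((Finset.univ.filter b.IsPos).filter (fun i ↦ ¬ b.IsPos (g • i))).card) = 1 := by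
    rw [← mk_ncard_length_weylGroup_eq_sum b W hW, ← coeff_zero_eq_constantCoeff_apply, coeff_mk]
    have h5 : {g : P.weylGroup | PreCoxeterSystem.length (fun j : b.support ↦ RootPairing.weylGroup.ofIdx P (j : ι)) g = 0} = {1} := by
      ext g
      rw [Set.mem_setOf_eq, Set.mem_singleton_iff, (isPreCoxeterSystem_weylGroup b).length_eq_zero_iff]
    rw [h5, Set.ncard_singleton, Nat.cast_one]
  have h4 : constantCoeff (∑ g ∈ W, (X : PowerSeries ℤ) ^ (∑ j, a j * (if b.IsPos (g • (j : ι)) then 0 else 1) -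
      ((Finset.univ.filter b.IsPos).filter (fun i ↦ ¬ b.IsPos (g • i))).card)) =
        ((W.filter (fun g ↦ ∑ j, a j * (if b.IsPos (g • (j : ι)) then 0 else 1) =
          ((Finset.univ.filter b.IsPos).filter (fun i ↦ ¬ b.IsPos (g • i))).card)).card : ℤ) := by
    rw [map_sum]
    simp_rw [← coeff_zero_eq_constantCoeff_apply, coeff_X_pow]
    rw [Finset.sum_boole]
    congr 2
    refine Finset.filter_congr fun g _ ↦ ?_
    have hle := card_filter_le_sum_mul_ite b hϖ hη ha g
    omega
  rw [map_nsmul, map_mul, map_mul, h1, h2, h3, h4, mul_one, one_mul, nsmul_eq_mul, mul_one] at h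
  exact_mod_cast h.symm

end Proposition130

end Base

end Literature.LinearAlgebra.RootSystem
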